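import Mathlib
import Summits.AnomalousDissipation.AnomalousDissipation.Theorems.MarginalStabilityChainBurgersLayerKHLine
import Literature.Analysis.ODE.LinearSecondOrder

/-!
# Rayleigh Jost solutions of the erf shear layer (stub `stub_rayleighJost`, line `Sketch`)

Crux `MarginalStabilityChain.BurgersLayerKH` (stmt-AnomalousDissipation-3008), line `Sketch`:
the registered stub

  `stub_rayleighJost : (∀ k, 1 ≤ k → ∀ A, VolterraPackage k A) → ∀ ℓ, 0 < ℓ → RayleighJostPackage ℓ`.

At `h = 0` the slow-mode equation `(λ + iU)ω = -iU''ψ`, `ω = -(ψ'' - α²ψ)`, is Rayleigh's equation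
`ψ'' = (α² + V)ψ` with `V = iU''/(λ + iU)`; for `re λ ≥ ℓ > 0` one has `|λ + iU| ≥ ℓ`, so `V` is
smooth with `‖V(y)‖ ≤ |y|e^{-y²/2}/ℓ ≤ e^{-y²/4}/ℓ`.  The Jost solution is `ψ = e^{-αy} m`, where
`m = 1 + ∫_{t>y} k_α(t-y) V m` comes from the weighted Volterra package (`k = 1`, `A = 1/ℓ`,
`g = 1`; its constant is uniform in `α ∈ (0,1]` and `λ`).  Splitting the kernel
`k_α(t-y) = (1 - e^{2αy}e^{-2αt})/(2α)` and differentiating the two tail integrals gives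
`m' = -e^{2αy}∫_{t>y} e^{-2αt} V m` and `m'' = 2α m' + V m`, whence `m` is smooth
(`Literature.Analysis.ODE.contDiffOn_of_solution`) and `ψ'' = (α² + V)ψ`, i.e. `ω = -Vψ` is of
Gaussian class; `m → 1` at `+∞` as the tail of an integrable function.

References: Drazin–Reid, *Hydrodynamic Stability* (2nd ed. 2004) §23; Hartman, *Ordinary
Differential Equations* (SIAM 2002) Ch. IV–V (regularity bootstrap).
-/

set_option linter.dupNamespace false

noncomputable section

open Complex MeasureTheory Filter Topology Set Metric

namespace Summit.AnomalousDissipation.AnomalousDissipation.Theorems.BurgersLayerKH.Sheet.RayleighJost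

open scoped ContDiff

/-! ## Generic tools: a Gaussian moment, derivative and tail of `y ↦ ∫_{t>y} f` -/

/-- `(1 + |t|) e^{-b t²}` is integrable on `ℝ` for `b > 0`. [folklore] -/
theorem integrable_one_add_abs_mul_exp {b : ℝ} (hb : 0 < b) :
    Integrable fun t : ℝ => (1 + |t|) * Real.exp (-b * t ^ 2) := by
  have h := (integrable_exp_neg_mul_sq hb).add (integrable_mul_exp_neg_mul_sq hb).norm
  refine h.congr (ae_of_all _ fun t => ?_)
  simp only [Pi.add_apply, norm_mul, Real.norm_eq_abs, abs_of_pos (Real.exp_pos _)]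
  ring

/-- Derivative of the tail integral of a continuous integrable function:
`d/dy ∫_{t>y} f(t) dt = -f(y)`. [folklore] -/
theorem hasDerivAt_integral_Ioi {E : Type*} [NormedAddCommGroup E] [NormedSpace ℝ E]
    [CompleteSpace E] {f : ℝ → E} (hf : Continuous f) (hfi : Integrable f) (y : ℝ) :
    HasDerivAt (fun x => ∫ t in Ioi x, f t) (-f y) y := by
  have h : (fun x => ∫ t in Ioi x, f t) = fun x => (∫ t in Ioi 0, f t) - ∫ t in (0:ℝ)..x, f t := by
    funext x
    rw [← intervalIntegral.integral_Ioi_sub_Ioi' hfi.integrableOn hfi.integrableOn]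
    abel
  rw [h]
  exact (hf.integral_hasStrictDerivAt 0 y).hasDerivAt.const_sub _

/-- The tail integral of an integrable function tends to `0` at `+∞`. [folklore] -/
theorem tendsto_integral_Ioi_atTop {E : Type*} [NormedAddCommGroup E] [NormedSpace ℝ E]
    [CompleteSpace E] {f : ℝ → E} (hfi : Integrable f) :
    Tendsto (fun x => ∫ t in Ioi x, f t) atTop (𝓝 0) := by
  have h : (fun x => ∫ t in Ioi x, f t) = fun x => (∫ t in Ioi 0, f t) - ∫ t in (0:ℝ)..x, f t := by
    funext x
    rw [← intervalIntegral.integral_Ioi_sub_Ioi' hfi.integrableOn hfi.integrableOn]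
    abel
  rw [h, ← sub_self (∫ t in Ioi (0:ℝ), f t)]
  exact tendsto_const_nhds.sub (intervalIntegral_tendsto_integral_Ioi 0 hfi.integrableOn tendsto_id)

/-! ## The profile `U` -/

/-- `U'(y) = e^{-y²/2}` (fundamental theorem of calculus). [folklore] -/
theorem hasDerivAt_U (y : ℝ) : HasDerivAt U (Real.exp (-(y ^ 2) / 2)) y :=
  (Continuous.integral_hasStrictDerivAt (f := fun s : ℝ => Real.exp (-(s ^ 2) / 2))
    (by fun_prop) 0 y).hasDerivAt

/-- `U` is smooth. [folklore] -/
theorem contDiff_U : ContDiff ℝ ∞ U := by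
  have hd : deriv U = fun y => Real.exp (-(y ^ 2) / 2) := funext fun y => (hasDerivAt_U y).deriv
  refine contDiff_infty_iff_deriv.2 ⟨fun y => (hasDerivAt_U y).differentiableAt, ?_⟩
  rw [hd]
  fun_prop

/-- For `re λ ≥ ℓ` the Rayleigh denominator `λ + iU(y)` has norm `≥ ℓ`. [folklore] -/
theorem le_norm_denom {ℓ : ℝ} {lam : ℂ} (hlam : ℓ ≤ lam.re) (y : ℝ) : ℓ ≤ ‖lam + I * U y‖ := by
  refine hlam.trans (le_trans (le_of_eq ?_) (Complex.re_le_norm _))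
  simp

/-- For `re λ ≥ ℓ > 0` the Rayleigh denominator `λ + iU(y)` does not vanish. [folklore] -/
theorem denom_ne_zero {ℓ : ℝ} (hℓ : 0 < ℓ) {lam : ℂ} (hlam : ℓ ≤ lam.re) (y : ℝ) :
    lam + I * U y ≠ 0 := by
  intro h
  have := le_norm_denom hlam y
  rw [h, norm_zero] at this
  linarith

/-- The Rayleigh potential `V = iU''/(λ + iU)` is smooth for `re λ ≥ ℓ > 0`. [folklore] -/
theorem contDiff_potential {ℓ : ℝ} (hℓ : 0 < ℓ) {lam : ℂ} (hlam : ℓ ≤ lam.re) :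
    ContDiff ℝ ∞ (fun y => I * (Upp y : ℂ) / (lam + I * (U y : ℂ))) := by
  have hU : ContDiff ℝ ∞ (fun y => (U y : ℂ)) := ofRealCLM.contDiff.comp contDiff_U
  have hUpp_r : ContDiff ℝ ∞ Upp := by
    unfold Upp
    fun_prop
  have hUpp : ContDiff ℝ ∞ (fun y => (Upp y : ℂ)) := ofRealCLM.contDiff.comp hUpp_r
  simp only [div_eq_mul_inv]
  exact (contDiff_const.mul hUpp).mul
    ((contDiff_const.add (contDiff_const.mul hU)).inv fun y => denom_ne_zero hℓ hlam y)

/-- `|y| e^{-y²/2} ≤ e^{-y²/4}`. [folklore] -/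
theorem abs_mul_exp_le (y : ℝ) : |y| * Real.exp (-(y ^ 2) / 2) ≤ Real.exp (-(y ^ 2) / 4) := by
  have h1 : |y| ≤ Real.exp (y ^ 2 / 4) := by
    have := Real.add_one_le_exp (y ^ 2 / 4)
    nlinarith [sq_nonneg (|y| - 2), sq_abs y]
  calc |y| * Real.exp (-(y ^ 2) / 2) ≤ Real.exp (y ^ 2 / 4) * Real.exp (-(y ^ 2) / 2) :=
        mul_le_mul_of_nonneg_right h1 (Real.exp_pos _).le
    _ = Real.exp (-(y ^ 2) / 4) := by rw [← Real.exp_add]; congr 1; ring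

/-- The size of the Rayleigh potential: `‖iU''/(λ + iU)‖ ≤ |y| e^{-y²/2} / ℓ` for `re λ ≥ ℓ > 0`.
[folklore] -/
theorem norm_potential_le {ℓ : ℝ} (hℓ : 0 < ℓ) {lam : ℂ} (hlam : ℓ ≤ lam.re) (y : ℝ) :
    ‖I * (Upp y : ℂ) / (lam + I * (U y : ℂ))‖ ≤ 1 / ℓ * (|y| * Real.exp (-(y ^ 2) / 2)) := by
  rw [norm_div, norm_mul, Complex.norm_I, one_mul, Complex.norm_real, Real.norm_eq_abs]
  have hUpp : |Upp y| = |y| * Real.exp (-(y ^ 2) / 2) := by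
    rw [Upp, abs_neg, abs_mul, abs_of_pos (Real.exp_pos _)]
  rw [hUpp, div_eq_mul_inv, mul_comm, one_div]
  exact mul_le_mul_of_nonneg_right (inv_anti₀ hℓ (le_norm_denom hlam y)) (by positivity)

/-- The weight inequality `|y| (1+|y|) e^{-y²/2} e^{-αy} ≤ e⁹ e^{-y²/4}` for `0 ≤ α ≤ 1`.
[folklore] -/
theorem weight_le {α : ℝ} (hα : 0 ≤ α) (hα1 : α ≤ 1) (y : ℝ) :
    |y| * (1 + |y|) * Real.exp (-(y ^ 2) / 2) * Real.exp (-(α * y)) ≤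
      Real.exp 9 * Real.exp (-(y ^ 2) / 4) := by
  have h1 : |y| ≤ Real.exp |y| := by
    have := Real.add_one_le_exp |y|
    linarith [abs_nonneg y]
  have h2 : 1 + |y| ≤ Real.exp |y| := by
    have := Real.add_one_le_exp |y|
    linarith
  have h3 : Real.exp (-(α * y)) ≤ Real.exp |y| := by
    refine Real.exp_le_exp.2 ?_
    rcases abs_cases y with ⟨h, _⟩ | ⟨h, _⟩ <;> rw [h] <;> nlinarith
  have h4 : Real.exp |y| * Real.exp |y| * Real.exp (-(y ^ 2) / 2) * Real.exp |y| ≤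
      Real.exp 9 * Real.exp (-(y ^ 2) / 4) := by
    rw [← Real.exp_add, ← Real.exp_add, ← Real.exp_add, ← Real.exp_add]
    exact Real.exp_le_exp.2 (by nlinarith [sq_nonneg (|y| - 6), sq_abs y])
  calc _ ≤ Real.exp |y| * Real.exp |y| * Real.exp (-(y ^ 2) / 2) * Real.exp |y| :=
        mul_le_mul (mul_le_mul_of_nonneg_right (mul_le_mul h1 h2 (by positivity) (by positivity))
          (by positivity)) h3 (by positivity) (by positivity)
    _ ≤ _ := h4

/-! ## Regularity of Jost–Volterra solutions -/

/-- **Regularity of the Jost–Volterra solution.** For `α > 0`, continuous `V` of Gaussian class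
and a continuous, linearly bounded solution `m` of `m(y) = 1 + ∫_{t>y} k_α(t-y) V(t) m(t) dt`
(`k_α(u) = (1 - e^{-2αu})/(2α)`), `m` is differentiable, `D := m' = -e^{2αy}∫_{t>y} e^{-2αt} V m`
satisfies `D' = 2α D + V m` (so `m'' - 2α m' = V m`), and `m(y) → 1` as `y → +∞`. [folklore] -/
theorem jost_regularity {α A C : ℝ} (hα : 0 < α) {V m : ℝ → ℂ} (hVc : Continuous V)
    (hVb : ∀ t, ‖V t‖ ≤ A * Real.exp (-(t ^ 2) / 4)) (hmc : Continuous m)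
    (hmb : ∀ t, ‖m t‖ ≤ C * (1 + |t|))
    (hm : ∀ y, m y = 1 + ∫ t in Ioi y, (volterraKernel α (t - y) : ℂ) * V t * m t) :
    ∃ D : ℝ → ℂ, (∀ y, HasDerivAt m (D y) y) ∧
      (∀ y, HasDerivAt D (2 * α * D y + V y * m y) y) ∧ Tendsto m atTop (𝓝 1) := by
  have hAC : ∀ t, ‖V t‖ * ‖m t‖ ≤ A * Real.exp (-(t ^ 2) / 4) * (C * (1 + |t|)) := fun t =>
    mul_le_mul (hVb t) (hmb t) (norm_nonneg _) ((norm_nonneg _).trans (hVb t))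
  have hA : 0 ≤ A := by
    have h := (norm_nonneg _).trans (hVb 0)
    simpa using h
  have hC : 0 ≤ C := by
    have h := (norm_nonneg _).trans (hmb 0)
    simpa using h
  -- the two integrands `F = V m` and `G = e^{-2αt} V m`
  obtain ⟨F, hF⟩ : ∃ F : ℝ → ℂ, F = fun t => V t * m t := ⟨_, rfl⟩
  obtain ⟨G, hG⟩ : ∃ G : ℝ → ℂ, G = fun t => (Real.exp (-(2 * α * t)) : ℂ) * F t := ⟨_, rfl⟩
  have hFc : Continuous F := hF ▸ hVc.mul hmc
  have hGc : Continuous G := hG ▸ (continuous_ofReal.comp (by fun_prop)).mul hFc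
  have hFi : Integrable F := by
    refine Integrable.mono' ((integrable_one_add_abs_mul_exp (by norm_num : (0:ℝ) < 1 / 4)).const_mul
      (A * C)) hFc.aestronglyMeasurable (ae_of_all _ fun t => ?_)
    rw [hF, norm_mul]
    calc ‖V t‖ * ‖m t‖ ≤ A * Real.exp (-(t ^ 2) / 4) * (C * (1 + |t|)) := hAC t
      _ = A * C * ((1 + |t|) * Real.exp (-(1 / 4) * t ^ 2)) := by
          rw [show -(1 / 4) * t ^ 2 = -(t ^ 2) / 4 by ring]; ring
  have hGi : Integrable G := by
    refine Integrable.mono' ((integrable_one_add_abs_mul_exp (by norm_num : (0:ℝ) < 1 / 8)).const_mul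
      (A * C * Real.exp (8 * α ^ 2))) hGc.aestronglyMeasurable (ae_of_all _ fun t => ?_)
    have key : Real.exp (-(2 * α * t)) * Real.exp (-(t ^ 2) / 4) ≤
        Real.exp (8 * α ^ 2) * Real.exp (-(1 / 8) * t ^ 2) := by
      rw [← Real.exp_add, ← Real.exp_add]
      exact Real.exp_le_exp.2 (by nlinarith [sq_nonneg (t + 8 * α)])
    rw [hG, hF]
    dsimp only
    rw [norm_mul, norm_mul, Complex.norm_of_nonneg (Real.exp_pos _).le]
    calc Real.exp (-(2 * α * t)) * (‖V t‖ * ‖m t‖)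
        ≤ Real.exp (-(2 * α * t)) * (A * Real.exp (-(t ^ 2) / 4) * (C * (1 + |t|))) :=
          mul_le_mul_of_nonneg_left (hAC t) (Real.exp_pos _).le
      _ = A * C * (1 + |t|) * (Real.exp (-(2 * α * t)) * Real.exp (-(t ^ 2) / 4)) := by ring
      _ ≤ A * C * (1 + |t|) * (Real.exp (8 * α ^ 2) * Real.exp (-(1 / 8) * t ^ 2)) :=
          mul_le_mul_of_nonneg_left key (by positivity)
      _ = _ := by ring
  -- the kernel, split into its two exponentials
  have hker : ∀ y t, (volterraKernel α (t - y) : ℂ) * V t * m t =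
      (1 / (2 * α) : ℂ) * F t - (Real.exp (2 * α * y) : ℂ) / (2 * α) * G t := by
    intro y t
    have hk : volterraKernel α (t - y) =
        (1 - Real.exp (2 * α * y) * Real.exp (-(2 * α * t))) / (2 * α) := by
      rw [← Real.exp_add, show 2 * α * y + -(2 * α * t) = -(2 * α * (t - y)) by ring]
      simp [volterraKernel, hα.ne']
    rw [hk, hG, hF]
    simp only [Complex.ofReal_div, Complex.ofReal_sub, Complex.ofReal_mul, Complex.ofReal_one,
      Complex.ofReal_ofNat]
    ring
  have hint : ∀ y, ∫ t in Ioi y, (volterraKernel α (t - y) : ℂ) * V t * m t =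
      (1 / (2 * α) : ℂ) * (∫ t in Ioi y, F t) -
        (Real.exp (2 * α * y) : ℂ) / (2 * α) * ∫ t in Ioi y, G t := by
    intro y
    simp_rw [hker y]
    rw [integral_sub ((hFi.const_mul _).integrableOn) ((hGi.const_mul _).integrableOn),
      integral_const_mul, integral_const_mul]
  -- derivatives
  have hPd : ∀ y, HasDerivAt (fun x => ∫ t in Ioi x, F t) (-F y) y :=
    hasDerivAt_integral_Ioi hFc hFi
  have hQd : ∀ y, HasDerivAt (fun x => ∫ t in Ioi x, G t) (-G y) y :=
    hasDerivAt_integral_Ioi hGc hGi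
  have hE : ∀ y, HasDerivAt (fun x => (Real.exp (2 * α * x) : ℂ))
      ((Real.exp (2 * α * y) * (2 * α) : ℝ) : ℂ) y := by
    intro y
    have h1 : HasDerivAt (fun x : ℝ => 2 * α * x) (2 * α) y :=
      (hasDerivAt_mul_const (2 * α)).congr_of_eventuallyEq (Eventually.of_forall fun x => by ring)
    exact h1.exp.ofReal_comp
  have hEG : ∀ y, (Real.exp (2 * α * y) : ℂ) * G y = F y := by
    intro y
    rw [hG]
    dsimp only
    rw [← mul_assoc, ← Complex.ofReal_mul, ← Real.exp_add, add_neg_cancel, Real.exp_zero,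
      Complex.ofReal_one, one_mul]
  have hα2 : (α : ℂ) ≠ 0 := by exact_mod_cast hα.ne'
  have hR : ∀ y, HasDerivAt (fun x => 1 + (1 / (2 * α) : ℂ) * (∫ t in Ioi x, F t) -
      (Real.exp (2 * α * x) : ℂ) / (2 * α) * ∫ t in Ioi x, G t)
      ((1 / (2 * α) : ℂ) * (-F y) - (((Real.exp (2 * α * y) * (2 * α) : ℝ) : ℂ) / (2 * α) *
        (∫ t in Ioi y, G t) + (Real.exp (2 * α * y) : ℂ) / (2 * α) * (-G y))) y := fun y =>
    (((hPd y).const_mul _).const_add _).fun_sub (((hE y).div_const _).fun_mul (hQd y))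
  have hmD : ∀ y, HasDerivAt m (-(Real.exp (2 * α * y) : ℂ) * ∫ t in Ioi y, G t) y := by
    intro y
    refine ((hR y).congr_of_eventuallyEq (Eventually.of_forall fun x => ?_)).congr_deriv ?_
    · simp only [hm x, hint x]
      ring
    · rw [← hEG y]
      push_cast
      field_simp
      ring
  have hDd : ∀ y, HasDerivAt (fun x => -(Real.exp (2 * α * x) : ℂ) * ∫ t in Ioi x, G t)
      (2 * α * (-(Real.exp (2 * α * y) : ℂ) * ∫ t in Ioi y, G t) + V y * m y) y := by
    intro y
    refine ((hE y).fun_neg.fun_mul (hQd y)).congr_deriv ?_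
    have hVm : V y * m y = F y := by rw [hF]
    rw [hVm, ← hEG y]
    push_cast
    ring
  refine ⟨fun x => -(Real.exp (2 * α * x) : ℂ) * ∫ t in Ioi x, G t, hmD, hDd, ?_⟩
  -- the limit `m → 1` at `+∞`
  have hT : Tendsto (fun y => ∫ t in Ioi y, ‖F t‖) atTop (𝓝 0) :=
    tendsto_integral_Ioi_atTop hFi.norm
  have hbound : ∀ y, ‖m y - 1‖ ≤ 1 / (2 * α) * ∫ t in Ioi y, ‖F t‖ := by
    intro y
    rw [hm y, add_sub_cancel_left, ← integral_const_mul]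
    refine norm_integral_le_of_norm_le ((hFi.norm.const_mul _).integrableOn) ?_
    rw [ae_restrict_iff' measurableSet_Ioi]
    refine ae_of_all _ fun t (ht : y < t) => ?_
    have h1 : Real.exp (-(2 * α * (t - y))) ≤ 1 :=
      Real.exp_le_one_iff.2 (by nlinarith [mul_pos hα (sub_pos.2 ht)])
    have h2 : 0 < Real.exp (-(2 * α * (t - y))) := Real.exp_pos _
    have hk0 : 0 ≤ volterraKernel α (t - y) := by
      simp only [volterraKernel, if_neg hα.ne']
      exact div_nonneg (by linarith) (by linarith)
    have hk1 : volterraKernel α (t - y) ≤ 1 / (2 * α) := by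
      simp only [volterraKernel, if_neg hα.ne']
      exact div_le_div_of_nonneg_right (by linarith) (by linarith)
    rw [mul_assoc, norm_mul, Complex.norm_of_nonneg hk0, hF]
    exact mul_le_mul_of_nonneg_right hk1 (norm_nonneg _)
  rw [tendsto_iff_norm_sub_tendsto_zero]
  refine squeeze_zero (fun y => norm_nonneg _) hbound ?_
  simpa using hT.const_mul (1 / (2 * α))

/-- Solutions of `m' = D`, `D' = 2α D + V m` with smooth `V` are smooth. [folklore] -/
theorem jost_contDiff {α : ℝ} {V m D : ℝ → ℂ} (hV : ContDiff ℝ ∞ V) (h1 : ∀ y, HasDerivAt m (D y) y)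
    (h2 : ∀ y, HasDerivAt D (2 * α * D y + V y * m y) y) : ContDiff ℝ ∞ m := by
  have h := (Literature.Analysis.ODE.contDiffOn_of_solution (𝕜 := ℂ) isOpen_univ
    (p := fun _ => (2 * α : ℂ)) (q := V) (u := m) (u' := D) contDiffOn_const hV.contDiffOn
    (fun t _ => ⟨h1 t, h2 t⟩)).1
  exact contDiffOn_univ.1 h

/-- If `m' = D` and `D' = 2α D + V m`, then `ψ = e^{-αy} m` satisfies Rayleigh's equation
`ψ'' = (α² + V) ψ`. [folklore] -/
theorem iteratedDeriv_two_psi {α : ℝ} {V m D : ℝ → ℂ} (h1 : ∀ y, HasDerivAt m (D y) y)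
    (h2 : ∀ y, HasDerivAt D (2 * α * D y + V y * m y) y) (y : ℝ) :
    iteratedDeriv 2 (fun x => (Real.exp (-(α * x)) : ℂ) * m x) y =
      ((α : ℂ) ^ 2 + V y) * ((Real.exp (-(α * y)) : ℂ) * m y) := by
  have he : ∀ x, HasDerivAt (fun x => (Real.exp (-(α * x)) : ℂ))
      ((Real.exp (-(α * x)) * -α : ℝ) : ℂ) x := by
    intro x
    have h1 : HasDerivAt (fun x : ℝ => -(α * x)) (-α) x :=
      (hasDerivAt_mul_const (-α)).congr_of_eventuallyEq (Eventually.of_forall fun y => by ring)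
    exact h1.exp.ofReal_comp
  have hψ1 : ∀ x, HasDerivAt (fun x => (Real.exp (-(α * x)) : ℂ) * m x)
      ((Real.exp (-(α * x)) : ℂ) * (D x - α * m x)) x := by
    intro x
    refine ((he x).fun_mul (h1 x)).congr_deriv ?_
    push_cast
    ring
  have hd1 : deriv (fun x => (Real.exp (-(α * x)) : ℂ) * m x) =
      fun x => (Real.exp (-(α * x)) : ℂ) * (D x - α * m x) :=
    funext fun x => (hψ1 x).deriv
  have hψ2 : HasDerivAt (fun x => (Real.exp (-(α * x)) : ℂ) * (D x - α * m x))
      (((α : ℂ) ^ 2 + V y) * ((Real.exp (-(α * y)) : ℂ) * m y)) y := by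
    refine ((he y).fun_mul ((h2 y).fun_sub ((h1 y).const_mul (α : ℂ)))).congr_deriv ?_
    push_cast
    ring
  rw [iteratedDeriv_succ, iteratedDeriv_one, hd1, hψ2.deriv]

/-! ## The stub -/

/-- **Rayleigh Jost solutions of the erf layer** (`h = 0` slow modes on `re λ ≥ ℓ > 0`, with an
`α`-uniform growth constant): from the weighted Volterra theory, for `α ∈ (0,1]` and `re λ ≥ ℓ`
the function `ψ = e^{-αy} m`, `m = 1 + ∫_{t>y} k_α(t-y) V m`, `V = iU''/(λ + iU)`, is a `C⁴`
(indeed smooth) solution of Rayleigh's equation `ψ'' = (α² + V)ψ` with Gaussian-class vorticity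
`-Vψ`, `e^{αy}ψ → 1` at `+∞` and `‖e^{αy}ψ‖ ≤ C₀(1+|y|)`, `C₀` the Volterra constant for `k = 1`,
`A = 1/ℓ`. [folklore] -/
theorem stub_rayleighJost : (∀ k : ℕ, 1 ≤ k → ∀ A : ℝ, VolterraPackage k A) → ∀ ℓ : ℝ, 0 < ℓ → RayleighJostPackage ℓ := by
  intro hVolt ℓ hℓ
  obtain ⟨C, hC⟩ := hVolt 1 le_rfl (1 / ℓ)
  refine ⟨C, fun α hα hα1 lam hlam => ?_⟩
  -- the Rayleigh potential
  obtain ⟨V, hV⟩ : ∃ V : ℝ → ℂ, V = fun y => I * (Upp y : ℂ) / (lam + I * (U y : ℂ)) := ⟨_, rfl⟩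
  have hVs : ContDiff ℝ ∞ V := hV ▸ contDiff_potential hℓ hlam
  have hVc : Continuous V := hVs.continuous
  have hV1 : ∀ y, ‖V y‖ ≤ 1 / ℓ * (|y| * Real.exp (-(y ^ 2) / 2)) := fun y =>
    hV ▸ norm_potential_le hℓ hlam y
  have hV2 : ∀ y, ‖V y‖ ≤ 1 / ℓ * Real.exp (-(y ^ 2) / 4) := fun y =>
    (hV1 y).trans (mul_le_mul_of_nonneg_left (abs_mul_exp_le y) (by positivity))
  have hVmul : ∀ y, (lam + I * U y) * V y = I * Upp y := by
    intro y
    rw [hV]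
    dsimp only
    rw [← mul_div_assoc, mul_div_cancel_left₀ _ (denom_ne_zero hℓ hlam y)]
  -- the Jost solution `m` from the Volterra package (`k = 1`, `g = 1`)
  obtain ⟨⟨m, hmc, hmb, hmeq⟩, -⟩ := hC α hα.le hα1 V hVc hV2 (fun _ => 1) continuous_const
    (fun y => by rw [norm_one, pow_one]; linarith [abs_nonneg y])
  simp only [pow_one] at hmb
  have hC0 : 0 ≤ C := by
    have h := (norm_nonneg _).trans (hmb 0)
    simpa using h
  obtain ⟨D, hmD, hDd, hlim⟩ := jost_regularity hα hVc hV2 hmc hmb hmeq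
  have hmsmooth : ContDiff ℝ ∞ m := jost_contDiff hVs hmD hDd
  -- `ψ = e^{-αy} m`
  have hweight : ∀ y, (Real.exp (α * y) : ℂ) * ((Real.exp (-(α * y)) : ℂ) * m y) = m y := by
    intro y
    rw [← mul_assoc, ← Complex.ofReal_mul, ← Real.exp_add, add_neg_cancel, Real.exp_zero,
      Complex.ofReal_one, one_mul]
  have hvort : ∀ y, vort α (fun x => (Real.exp (-(α * x)) : ℂ) * m x) y =
      -(V y * ((Real.exp (-(α * y)) : ℂ) * m y)) := by
    intro y
    rw [vort, iteratedDeriv_two_psi hmD hDd y]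
    ring
  have hexp_r : ContDiff ℝ 4 (fun x => Real.exp (-(α * x))) := by fun_prop
  have hexp : ContDiff ℝ 4 (fun x => (Real.exp (-(α * x)) : ℂ)) := ofRealCLM.contDiff.comp hexp_r
  refine ⟨fun x => (Real.exp (-(α * x)) : ℂ) * m x, ?_, fun y => by rw [hweight]; exact hmb y⟩
  refine ⟨hexp.mul (contDiff_infty.1 hmsmooth 4), fun y => ?_, ⟨C * Real.exp 9 / ℓ, fun y => ?_⟩,
    ?_, ⟨C, fun y => by rw [hweight]; exact hmb y⟩⟩
  · -- Rayleigh's equation in vorticity form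
    rw [hvort, Complex.ofReal_zero, zero_mul, sub_zero, ← hVmul]
    ring
  · -- Gaussian class of the vorticity `-Vψ`
    rw [hvort, norm_neg, norm_mul, norm_mul, Complex.norm_of_nonneg (Real.exp_pos _).le]
    calc ‖V y‖ * (Real.exp (-(α * y)) * ‖m y‖)
        ≤ 1 / ℓ * (|y| * Real.exp (-(y ^ 2) / 2)) * (Real.exp (-(α * y)) * (C * (1 + |y|))) :=
          mul_le_mul (hV1 y) (mul_le_mul_of_nonneg_left (hmb y) (Real.exp_pos _).le)
            (by positivity) (by positivity)
      _ = C / ℓ * (|y| * (1 + |y|) * Real.exp (-(y ^ 2) / 2) * Real.exp (-(α * y))) := by ring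
      _ ≤ C / ℓ * (Real.exp 9 * Real.exp (-(y ^ 2) / 4)) :=
          mul_le_mul_of_nonneg_left (weight_le hα.le hα1 y) (by positivity)
      _ = C * Real.exp 9 / ℓ * Real.exp (-(y ^ 2) / 4) := by ring
  · -- normalisation at `+∞`
    have h : (fun y => (Real.exp (α * y) : ℂ) * ((Real.exp (-(α * y)) : ℂ) * m y)) = m :=
      funext hweight
    rw [h]
    exact hlim

end Summit.AnomalousDissipation.AnomalousDissipation.Theorems.BurgersLayerKH.Sheet.RayleighJost

end
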